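import Literature.NumberTheory.GaloisRepresentations.LocalEulerPoincareCharacteristic
import Literature.NumberTheory.GaloisRepresentations.LocalDualityTwoZeroInputs
import Literature.NumberTheory.GaloisRepresentations.CyclicIndexEulerChar
import Literature.NumberTheory.GaloisRepresentations.PPrimaryDevissage
import HarnessLib

/-!
# Route `ByReductionTypeAtTwo`, item `OrdKatoHalfAtTwo` (stmt-BirchSwinnertonDyer-19271), TOWER road, the
# GOOD-ORDINARY local tower kernels at `v ∣ p` (ANY `p`): BRICK F — the Euler–Poincaré INEQUALITY for a finite
# `p`-primary module over an OPEN subgroup, from Tate's local Euler–Poincaré characteristic formula (named fact) by Shapiro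

HONEST FRAMING (cell `bsd-2adic`, run/shared/lean/pub/bsd-2adic/, seat `bsd-2adic-tower-1` GEN 20, HUMAN RULINGS
D-0036 / D-0054 / D-0074): TOOL theorem only (no definition, no new named fact, no `sorry`); closes nothing by itself;
nothing booked; BSD is not proved by any of this. CONDITIONAL brick: its hypothesis `localEulerPoincareCharacteristic F`
is the tree's named fact for Tate's local Euler–Poincaré characteristic formula (Milne ADT I Thm. 2.8) — a TREE THEOREM since
2026-08-21, `Literature.NumberTheory.GaloisRepresentations.localEulerPoincareCharacteristic_holds` (module
`Summits/…/Rank1Residual/GaloisImage/LocalEulerPoincareCharacteristicHolds`), fed by name in `…GoodOrdTowerControlAllP.lean` (GEN 21;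
doc corrected GEN 23 — the earlier parenthesis «the tree proves the cases μ_n, trivial coefficients and the dévissage step, not the
general finite module» was stale). Purpose: the all-`p` companion of
BRICKS C/C′ (which compute the count UNCONDITIONALLY at `p = 2`, where every constituent of `Ê[2^k]` is trivial): with it
the uniform layer bound on the local tower kernels — hence Greenberg's Lemma 3.5 and Mazur's control theorem
`WeierstrassCurve.selmer_control` over `ℚ` — follow at EVERY prime modulo Tate's formula instead of modulo Greenberg's
Lemma 3.4 (`Greenberg1999.lemma34_natCard_localTowerKerPrimary_eq_rat`).

* `natCard_one_restrict_le_of_localEP` — `F` a non-archimedean local field of characteristic `0` satisfying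
  `localEulerPoincareCharacteristic F`, `H ≤ Γ_F` open (normal), `M` a finite discrete `p`-primary `Γ_F`-module: `H¹(H, M)`,
  `H²(H, M)` are finite and `#H¹(H, M) ≤ #M^{H} · #H²(H, M) · #(𝒪[F]/p^m)` for some `m` with `p^m ≤ #M^{[Γ_F : H]}`
  (`p^m = #M_Γ^H(M)`, the order of the induced module). Proof: Tate's formula for the finite induced module `M_Γ^H(M)`,
  Shapiro in degrees `0, 1, 2` (`invariantsCoindEquiv`, `shapiroEquiv`), and `#M_Γ^H(M) ≤ #M^{[Γ:H]}` (an induced function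
  is determined by its values at coset representatives, `finite_coindModule`).

References: J. Milne, *Arithmetic Duality Theorems* (2006), I Thm. 2.8; J.-P. Serre, *Galois Cohomology* (1997), I §2.5,
II §5.7.
-/

set_option autoImplicit false
-- the Theorems namespace of this sub repeats the summit name by design (D-0017 nested layout: Summit.<S>.<Sub>)
set_option linter.dupNamespace false

noncomputable section

open scoped Classical

universe u

namespace Summit.BirchSwinnertonDyer.BirchSwinnertonDyer.Theorems.GoodOrdTower

open CategoryTheory Field Literature.NumberTheory.GaloisRepresentations _root_.TopRep _root_.ContRepresentation
  _root_.ContinuousCohomology Literature.NumberTheory.GaloisRepresentations.DiscreteGaloisModule ValuativeRel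

set_option maxHeartbeats 800000 in
/-- **The Euler–Poincaré inequality over an open subgroup, from Tate's formula by Shapiro.** Let `F` be a non-archimedean
local field of characteristic `0` for which Tate's local Euler–Poincaré characteristic formula holds (the tree's named fact
`localEulerPoincareCharacteristic F`), `H ≤ Γ_F` an open normal subgroup and `M` a finite discrete `p`-primary
`Γ_F`-module. Then `H¹(H, M)` and `H²(H, M)` are finite and
`#H¹(H, M) = #M^H · #H²(H, M) · #(𝒪[F]/p^m)` for some `m` with `p^m ≤ #M^{[Γ_F:H]}` (`p^m = #M_Γ^H(M)`): Tate's formula for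
the induced module and Shapiro's isomorphisms in degrees `0, 1, 2`.
[cite: MilneADT2006, I §2 Thm. 2.8] [cite: SerreGaloisCohomology1997, I §2.5 Prop. 10] -/
theorem natCard_one_restrict_le_of_localEP (F : Type u) [Field F] [ValuativeRel F] [TopologicalSpace F]
    [IsNonarchimedeanLocalField F] [CharZero F] (hEP : localEulerPoincareCharacteristic F)
    (H : Subgroup (absoluteGaloisGroup F)) [H.Normal] (hHo : IsOpen (H : Set (absoluteGaloisGroup F)))
    {M : Type u} [AddCommGroup M] [TopologicalSpace M] [DiscreteTopology M] [Finite M]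
    (ρ : ContinuousRep (absoluteGaloisGroup F) ℤ M) {p : ℕ} [Fact p.Prime] (hM : IsPrimaryTorsion p M) :
    Finite (continuousCohomology 1 (ρ.restrict (subgroupIncl H)).toTopRep) ∧
      Finite (continuousCohomology 2 (ρ.restrict (subgroupIncl H)).toTopRep) ∧
      ∃ m : ℕ, p ^ m ≤ Nat.card M ^ H.index ∧
        Nat.card (continuousCohomology 1 (ρ.restrict (subgroupIncl H)).toTopRep) =
          Nat.card (ρ.restrict (subgroupIncl H)).toTopRep.ρ.invariants *
            Nat.card (continuousCohomology 2 (ρ.restrict (subgroupIncl H)).toTopRep) *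
            Nat.card (𝒪[F] ⧸ Ideal.span {((p ^ m : ℕ) : 𝒪[F])}) := by
  let Γ := absoluteGaloisGroup F
  haveI : CompactSpace Γ := absoluteGaloisGroup_compactSpace F
  haveI hHc : IsClosed (H : Set Γ) := Subgroup.isClosed_of_isOpen _ hHo
  haveI : DiscreteTopology (Γ ⧸ H) := QuotientGroup.discreteTopology hHo
  haveI : Finite (Γ ⧸ H) := finite_of_compact_of_discrete
  haveI : CompactSpace H := compactSpace_of_isClosed_subgroup (S := H)
  let σ : ContinuousRep H ℤ M := ρ.restrict (subgroupIncl H)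
  haveI : DiscreteTopology (coindModule σ) := discreteTopology_coind σ
  haveI : Finite (coindModule σ) := finite_coindModule F H ρ
  -- Tate's formula for the induced module
  obtain ⟨hf1, hf2, hEPX⟩ := hEP (coindRep σ)
  haveI := hf1
  haveI := hf2
  -- Shapiro in degrees `0`, `1`, `2`
  have e1 := shapiroEquiv H ρ 0
  have e2 := shapiroEquiv H ρ 1
  have e0 := invariantsCoindEquiv H ρ
  have hf1' : Finite (continuousCohomology 1 σ.toTopRep) := Finite.of_equiv _ e1
  have hf2' : Finite (continuousCohomology 2 σ.toTopRep) := Finite.of_equiv _ e2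
  refine ⟨hf1', hf2', ?_⟩
  -- `#M_Γ^H(M) = p^m ≤ #M^{[Γ:H]}`
  obtain ⟨m, hm⟩ := exists_card_eq_prime_pow (p := p) (coindModule σ) (isPrimaryTorsion_coind σ hM)
  have hle : Nat.card (coindModule σ) ≤ Nat.card M ^ H.index := by
    -- an induced function is determined by its values at the inverses of coset representatives
    have hinj : Function.Injective (fun (f : coindModule σ) (c : Γ ⧸ H) ↦ (f : C(Γ, M)) c.out⁻¹) := by
      intro f f' hff'
      refine Subtype.ext (ContinuousMap.ext fun x ↦ ?_)
      have hc : ((QuotientGroup.mk x⁻¹ : Γ ⧸ H).out)⁻¹ * x⁻¹ ∈ H := by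
        rw [← QuotientGroup.eq, QuotientGroup.out_eq']
      have hsH : (((QuotientGroup.mk x⁻¹ : Γ ⧸ H).out)⁻¹ * x⁻¹)⁻¹ ∈ H := H.inv_mem hc
      have hx : x = (((QuotientGroup.mk x⁻¹ : Γ ⧸ H).out)⁻¹ * x⁻¹)⁻¹ * ((QuotientGroup.mk x⁻¹ : Γ ⧸ H).out)⁻¹ := by
        rw [mul_inv_rev, inv_inv, inv_inv, mul_inv_cancel_right]
      have e := congrFun hff' (QuotientGroup.mk x⁻¹)
      have key : ∀ g : coindModule σ, (g : C(Γ, M)) x =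
          σ ⟨_, hsH⟩ ((g : C(Γ, M)) ((QuotientGroup.mk x⁻¹ : Γ ⧸ H).out)⁻¹) := fun g ↦ by
        have h := (mem_coind_iff σ (g : C(Γ, M))).1 g.2 ⟨_, hsH⟩ ((QuotientGroup.mk x⁻¹ : Γ ⧸ H).out)⁻¹
        change (g : C(Γ, M)) (_ * _) = _ at h
        rw [← hx] at h
        exact h
      rw [key f, key f']
      exact congrArg _ e
    have h := Nat.card_le_card_of_injective _ hinj
    rw [Nat.card_fun] at h
    exact h
  refine ⟨m, hm ▸ hle, ?_⟩
  rw [← Nat.card_congr e1, ← Nat.card_congr e2, ← Nat.card_congr e0, ← hEPX, hm]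

end Summit.BirchSwinnertonDyer.BirchSwinnertonDyer.Theorems.GoodOrdTower

end
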